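import Literature.Probability.RandomPlanarGeometry.SchwarzianCapacity
import Literature.Probability.RandomPlanarGeometry.RestrictionHullsProofs

/-!
# The restriction map `Φ_A` at `∞`: `Im Φ(ξ)/Im ξ → 1` and `Φ'(ξ) → 1`

For a `*`-hull `A` and its [LSW] restriction map `Φ : ℍ ∖ A → ℍ` (`Φ(0) = 0`, `Φ(z)/z → 1` at
`∞`), the first-order behaviour at `∞` approached arbitrarily inside `ℍ ∖ A` — `Im Φ(ξ)/Im ξ → 1`
and `Φ'(ξ) → 1` — is deduced from the corresponding statement at `0` (with limit `d = Φ'_A(0)`),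
taken as a hypothesis, by conjugating with the inversion `ι(z) = -1/z` (a conformal involution of
`ℍ`): `Ψ(w) = d · ι(Φ(ι w)) = invertedMap Φ d _ 0` is a restriction map of the `*`-hull
`invHull A = ι(A)` with `Ψ'(0) = d`, and `Φ = d · ι ∘ Ψ ∘ ι` on `ℍ ∖ A`.
-/

noncomputable section

open scoped Topology
open Filter Set Function Metric Complex Bornology
open Literature.Probability.RandomPlanarGeometry
open UpperHalfPlane (upperHalfPlaneSet isOpen_upperHalfPlaneSet)

namespace Summit.CriticalPhenomena.SAWScalingLimit.Theorems.IsingBoundaryRatio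

variable {A : Set ℂ}

/-! ### The inverted hull of a `*`-hull is a `*`-hull -/

/-- `invHull A ∩ ℍ = ι(A ∩ ℍ)` (`ι(z) = -1/z` preserves `ℍ`). -/
theorem invHull_inter_upperHalfPlaneSet (A : Set ℂ) :
    invHull A ∩ upperHalfPlaneSet = (fun z : ℂ ↦ -z⁻¹) '' (A ∩ upperHalfPlaneSet) := by
  rw [← invHull_eq_image]
  simp only [invHull, preimage_inter, preimage_negInv_upperHalfPlaneSet]

/-- `ι(z) = -1/z` is continuous on every set missing `0`. -/
theorem continuousOn_neg_inv {S : Set ℂ} (hS : S ⊆ {z | z ≠ 0}) :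
    ContinuousOn (fun z : ℂ ↦ -z⁻¹) S :=
  (continuousOn_inv₀.mono fun _ hz ↦ hS hz).neg

/-- **`ℍ ∖ invHull A` is simply connected if `ℍ ∖ A` is**: `ι` restricts to a homeomorphism
`ℍ ∖ A ≃ₜ ℍ ∖ invHull A` (an involution, continuous away from `0`). -/
theorem isSimplyConnected_diff_invHull (h : IsSimplyConnected (upperHalfPlaneSet \ A)) :
    IsSimplyConnected (upperHalfPlaneSet \ invHull A) := by
  have hmaps : MapsTo (fun z : ℂ ↦ -z⁻¹) (upperHalfPlaneSet \ A) (upperHalfPlaneSet \ invHull A) := by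
    intro z hz
    rw [← preimage_negInv_diff]
    show -(-z⁻¹)⁻¹ ∈ upperHalfPlaneSet \ A
    rwa [neg_inv_neg_inv]
  have hmaps' : MapsTo (fun z : ℂ ↦ -z⁻¹) (upperHalfPlaneSet \ invHull A) (upperHalfPlaneSet \ A) :=
    fun w hw ↦ neg_inv_mem_diff hw
  let e : (upperHalfPlaneSet \ A : Set ℂ) ≃ₜ (upperHalfPlaneSet \ invHull A : Set ℂ) :=
    { toFun := hmaps.restrict _ _ _
      invFun := hmaps'.restrict _ _ _
      left_inv := fun z ↦ Subtype.ext (neg_inv_neg_inv z.1)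
      right_inv := fun w ↦ Subtype.ext (neg_inv_neg_inv w.1)
      continuous_toFun := (continuousOn_neg_inv (diff_subset_ne_zero A)).mapsToRestrict _
      continuous_invFun := (continuousOn_neg_inv (diff_subset_ne_zero _)).mapsToRestrict _ }
  have h' : SimplyConnectedSpace (upperHalfPlaneSet \ A : Set ℂ) := h
  change SimplyConnectedSpace (upperHalfPlaneSet \ invHull A : Set ℂ)
  exact e.toHomotopyEquiv.simplyConnectedSpace_iff.1 h'

/-- **The inverted hull of a `*`-hull is a bounded hull**: bounded since `A` is off a ball about
`0`; `closure (invHull A ∩ ℍ) = ι(closure (A ∩ ℍ)) = ι(A)` since `ι` is continuous on the compact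
set `A ∌ 0`; `ℍ ∖ invHull A ≃ₜ ℍ ∖ A` is simply connected. -/
theorem isBoundedHull_invHull (hA : IsStarHull A) : IsBoundedHull (invHull A) := by
  have hA0 : A ⊆ {z | z ≠ 0} := fun z hz h0 ↦ hA.2 (h0 ▸ hz)
  have hcont : ContinuousOn (fun z : ℂ ↦ -z⁻¹) A := continuousOn_neg_inv hA0
  refine ⟨?_, ?_, isSimplyConnected_diff_invHull hA.1.2.2⟩
  · -- bounded: `A` is off a ball about `0`
    have hAc : Aᶜ ∈ 𝓝 (0 : ℂ) := hA.1.isClosed.isOpen_compl.mem_nhds hA.2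
    obtain ⟨ε, hε, hball⟩ := Metric.mem_nhds_iff.1 hAc
    exact isBounded_closedBall.subset
      (invHull_subset_closedBall hε (subset_compl_iff_disjoint_right.1 hball))
  · -- `closure (invHull A ∩ ℍ) = invHull A`
    rw [invHull_inter_upperHalfPlaneSet]
    refine Subset.antisymm ?_ ?_
    · rw [invHull_eq_image]
      exact closure_minimal (image_mono inter_subset_left)
        (hA.1.isCompact.image_of_continuousOn hcont).isClosed
    · have hcl : closure (A ∩ upperHalfPlaneSet) = A := hA.1.closure_inter_eq
      have h : ContinuousOn (fun z : ℂ ↦ -z⁻¹) (closure (A ∩ upperHalfPlaneSet)) := by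
        rw [hcl]
        exact hcont
      have h' := h.image_closure
      rw [hcl, ← invHull_eq_image] at h'
      exact h'

/-- **The inverted hull of a `*`-hull is a `*`-hull** (`0 ∉ invHull A` as `ι(0) = 0 ∉ A`). -/
theorem isStarHull_invHull (hA : IsStarHull A) : IsStarHull (invHull A) := by
  refine ⟨isBoundedHull_invHull hA, fun h0 ↦ hA.2 ?_⟩
  have h : -(0 : ℂ)⁻¹ ∈ A := h0
  rwa [inv_zero, neg_zero] at h

/-! ### Filters and derivatives of `ι(z) = -1/z` -/

/-- `ι → 0` at `∞`. -/
theorem tendsto_neg_inv_cocompact : Tendsto (fun z : ℂ ↦ -z⁻¹) (cocompact ℂ) (𝓝 0) := by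
  rw [← cobounded_eq_cocompact]
  have h := (tendsto_inv₀_cobounded (α := ℂ)).neg
  rwa [neg_zero] at h

/-- **`-1/w → ∞` inside `ℍ ∖ A` as `w → 0` inside `ℍ ∖ invHull A`.** -/
theorem tendsto_neg_inv_nhdsWithin_zero (A : Set ℂ) :
    Tendsto (fun w : ℂ ↦ -w⁻¹) (𝓝[upperHalfPlaneSet \ invHull A] 0)
      (cocompact ℂ ⊓ 𝓟 (upperHalfPlaneSet \ A)) := by
  refine tendsto_inf.2 ⟨?_, tendsto_principal.2 ?_⟩
  · have h : Tendsto (fun w : ℂ ↦ -w⁻¹) (𝓝[≠] (0 : ℂ)) (cocompact ℂ) := by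
      rw [← cobounded_eq_cocompact]
      exact tendsto_neg_cobounded.comp tendsto_inv₀_nhdsNE_zero
    exact h.mono_left (nhdsWithin_mono _ (diff_subset_ne_zero _))
  · filter_upwards [self_mem_nhdsWithin] with w hw
    exact neg_inv_mem_diff hw

/-- `ι'(z) = 1/z²` for `z ≠ 0`. -/
theorem hasDerivAt_neg_inv {z : ℂ} (hz : z ≠ 0) : HasDerivAt (fun x : ℂ ↦ -x⁻¹) ((z ^ 2)⁻¹) z := by
  have h := (hasDerivAt_inv hz).neg
  rwa [neg_neg] at h

/-! ### Algebra of the conjugation `Ψ = d · ι ∘ Φ ∘ ι` -/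

/-- Undoing the conjugation: `d · ι(d · ι(a)) = a` for `d ≠ 0`. -/
theorem negInvConj_negInvConj {d : ℝ} (hd : d ≠ 0) (a : ℂ) :
    (d : ℂ) * (-((d : ℂ) * (-a⁻¹))⁻¹) = a := by
  have hd' : (d : ℂ) ≠ 0 := ofReal_ne_zero.2 hd
  simp only [mul_neg, inv_neg, neg_neg, mul_inv, inv_inv]
  rw [← mul_assoc, mul_inv_cancel₀ hd', one_mul]

/-- `Ψ(w)/w = d · (Φ(z)/z)⁻¹` for `Ψ(w) = d · ι(Φ(z))`, `z = ι(w)` (pure algebra: `a = Φ(z)`). -/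
theorem negInvConj_div (d a w : ℂ) : d * (-a⁻¹) / w = d * (a / (-w⁻¹))⁻¹ := by
  rw [inv_div]
  ring

/-- The imaginary-part ratio after conjugation by `ι` (pure algebra: `p = Ψ(ι ξ)`):
`Im(d ι(p)) / Im ξ = d (Im p / Im ι(ξ)) / |p / ι(ξ)|²`. -/
theorem im_div_im_negInvConj (d : ℝ) {p ξ : ℂ} (hp : p ≠ 0) (hξ : ξ ≠ 0) (hξi : ξ.im ≠ 0) :
    ((d : ℂ) * (-p⁻¹)).im / ξ.im = d * (p.im / (-ξ⁻¹).im) / ‖p / (-ξ⁻¹)‖ ^ 2 := by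
  have hp' : ‖p‖ ≠ 0 := norm_ne_zero_iff.2 hp
  have hξ' : ‖ξ‖ ≠ 0 := norm_ne_zero_iff.2 hξ
  rw [norm_div, norm_neg, norm_inv, im_ofReal_mul, neg_im, inv_im, neg_im, inv_im,
    normSq_eq_norm_sq, normSq_eq_norm_sq]
  field_simp

/-- The derivative after conjugation by `ι` (pure algebra: `p = Ψ(ι ξ)`, `q = Ψ'(ι ξ)`):
`d · p⁻² · q · ξ⁻² = d q / (p / ι(ξ))²`. -/
theorem deriv_negInvConj_eq (d q : ℂ) {p ξ : ℂ} (hp : p ≠ 0) (hξ : ξ ≠ 0) :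
    d * ((p ^ 2)⁻¹ * (q * (ξ ^ 2)⁻¹)) = d * q / (p / (-ξ⁻¹)) ^ 2 := by
  field_simp

/-! ### `Ψ = invertedMap Φ d _ 0` is a restriction map of `invHull A` with `Ψ'(0) = d` -/

/-- `ψ(w) = d · (−1/Φ(−1/w))` on `ℍ ∖ invHull A` (the inverted map with no translation). -/
theorem invertedMap_zero_apply (Φ : ConformalEquiv (upperHalfPlaneSet \ A) upperHalfPlaneSet)
    {d : ℝ} (hd : 0 < d) {w : ℂ} (hw : w ∈ upperHalfPlaneSet \ invHull A) :
    invertedMap Φ d hd 0 w = (d : ℂ) * (-(Φ (-w⁻¹))⁻¹) := by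
  rw [invertedMap_apply Φ hd 0 hw, ofReal_zero, sub_zero]

/-- **`Ψ = d · ιΦι` is a restriction map of `invHull A` with `Ψ'(0) = d`** when `Φ` is a
restriction map of `A` with `Φ'_A(0) = d > 0`: at `0`, `z = ι(w) → ∞` within `ℍ ∖ A`, so
`Φ(z) → ∞` and `Ψ(w) = d ι(Φ z) → 0`; and `Ψ(w)/w = d (Φ(z)/z)⁻¹` tends to `d/d = 1` as
`w → ∞` (`z → 0`) and to `d` as `w → 0` (`z → ∞`). -/
theorem isRestrictionMap_invertedMap
    {Φ : ConformalEquiv (upperHalfPlaneSet \ A) upperHalfPlaneSet} {d : ℝ}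
    (hΦ : IsRestrictionMap A Φ) (hdd : HasRestrictionDeriv A Φ d) (hd : 0 < d) :
    IsRestrictionMap (invHull A) (invertedMap Φ d hd 0) ∧
      HasRestrictionDeriv (invHull A) (invertedMap Φ d hd 0) d := by
  have hdC : (d : ℂ) ≠ 0 := ofReal_ne_zero.2 hd.ne'
  have hF1 := tendsto_neg_inv_nhdsWithin_zero A
  have hF2 := tendsto_neg_inv_cocompact_inf A
  have hmem0 : ∀ᶠ w in 𝓝[upperHalfPlaneSet \ invHull A] 0, w ∈ upperHalfPlaneSet \ invHull A :=
    self_mem_nhdsWithin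
  have hmeminf : ∀ᶠ w in cocompact ℂ ⊓ 𝓟 (upperHalfPlaneSet \ invHull A),
      w ∈ upperHalfPlaneSet \ invHull A :=
    mem_inf_of_right (mem_principal_self _)
  have hquot : ∀ w ∈ upperHalfPlaneSet \ invHull A,
      invertedMap Φ d hd 0 w / w = (d : ℂ) * (Φ (-w⁻¹) / (-w⁻¹))⁻¹ := fun w hw ↦ by
    rw [invertedMap_zero_apply Φ hd hw]
    exact negInvConj_div _ _ _
  refine ⟨⟨?_, ?_⟩, ?_⟩
  · -- boundary value `0` at `0`
    show Tendsto (fun w ↦ invertedMap Φ d hd 0 w) (𝓝[upperHalfPlaneSet \ invHull A] 0) (𝓝 0)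
    have h1 : Tendsto (fun w : ℂ ↦ Φ (-w⁻¹)) (𝓝[upperHalfPlaneSet \ invHull A] 0)
        (cocompact ℂ) :=
      (tendsto_cocompact_of_tendsto_div one_ne_zero hΦ.2).comp hF1
    have h2 : Tendsto (fun w : ℂ ↦ (d : ℂ) * (-(Φ (-w⁻¹))⁻¹))
        (𝓝[upperHalfPlaneSet \ invHull A] 0) (𝓝 ((d : ℂ) * 0)) :=
      (tendsto_neg_inv_cocompact.comp h1).const_mul _
    rw [mul_zero] at h2
    exact h2.congr' (hmem0.mono fun w hw ↦ (invertedMap_zero_apply Φ hd hw).symm)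
  · -- `Ψ(w)/w → 1` at `∞`
    have h1 : Tendsto (fun w : ℂ ↦ (d : ℂ) * (Φ (-w⁻¹) / (-w⁻¹))⁻¹)
        (cocompact ℂ ⊓ 𝓟 (upperHalfPlaneSet \ invHull A)) (𝓝 ((d : ℂ) * ((d : ℂ))⁻¹)) :=
      ((hdd.comp hF2).inv₀ hdC).const_mul _
    rw [mul_inv_cancel₀ hdC] at h1
    exact h1.congr' (hmeminf.mono fun w hw ↦ (hquot w hw).symm)
  · -- `Ψ(w)/w → d` at `0`
    show Tendsto (fun w ↦ invertedMap Φ d hd 0 w / w) (𝓝[upperHalfPlaneSet \ invHull A] 0)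
      (𝓝 (d : ℂ))
    have h1 : Tendsto (fun w : ℂ ↦ (d : ℂ) * (Φ (-w⁻¹) / (-w⁻¹))⁻¹)
        (𝓝[upperHalfPlaneSet \ invHull A] 0) (𝓝 ((d : ℂ) * (1 : ℂ)⁻¹)) :=
      ((hΦ.2.comp hF1).inv₀ one_ne_zero).const_mul _
    rw [inv_one, mul_one] at h1
    exact h1.congr' (hmem0.mono fun w hw ↦ (hquot w hw).symm)

/-! ### The statement at `∞` from the statement at `0` -/

/-- **`Φ_A` at `∞`, from `Φ_A` at `0` by inversion.** If for every `*`-hull `A` and restriction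
map `Φ` of `A` with `Φ'_A(0) = d` one has `Im Φ(ζ)/Im ζ → d` and `Φ'(ζ) → d` as `ζ → 0` inside
`ℍ ∖ A`, then for every `*`-hull `A` and restriction map `Φ` of `A`, `Im Φ(ξ)/Im ξ → 1` and
`Φ'(ξ) → 1` as `ξ → ∞` inside `ℍ ∖ A`. Proof: with `d = Φ'_A(0) > 0`
(`IsStarHull.exists_hasRestrictionDeriv_holds`), `Ψ(w) = d ι(Φ(ι w))` (`invertedMap Φ d _ 0`)
is a restriction map of the `*`-hull `invHull A` with `Ψ'(0) = d`; the hypothesis at `0` for `Ψ`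
is carried back along `w = ι(ξ) → 0` (`ξ → ∞`): `Φ(ξ) = d ι(Ψ(w))`,
`Im Φ(ξ)/Im ξ = d (Im Ψ(w)/Im w) / |Ψ(w)/w|² → d · d / d² = 1` and
`Φ'(ξ) = d Ψ'(w) / (Ψ(w)/w)² → d · d / d² = 1`. -/
theorem restrictionMapAtInfty_of_atZero :
    (∀ (A : Set ℂ) (Φ : ConformalEquiv (UpperHalfPlane.upperHalfPlaneSet \ A) UpperHalfPlane.upperHalfPlaneSet)
      (d : ℝ), IsStarHull A → IsRestrictionMap A Φ → HasRestrictionDeriv A Φ d →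
      Tendsto (fun ζ : ℂ => (Φ ζ).im / ζ.im) (𝓝[UpperHalfPlane.upperHalfPlaneSet \ A] 0) (𝓝 d) ∧
      Tendsto (fun ζ : ℂ => deriv (fun x => Φ x) ζ) (𝓝[UpperHalfPlane.upperHalfPlaneSet \ A] 0)
        (𝓝 (d : ℂ))) →
    ∀ (A : Set ℂ) (Φ : ConformalEquiv (UpperHalfPlane.upperHalfPlaneSet \ A) UpperHalfPlane.upperHalfPlaneSet),
      IsStarHull A → IsRestrictionMap A Φ →
      Tendsto (fun ξ : ℂ => (Φ ξ).im / ξ.im)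
        (cocompact ℂ ⊓ 𝓟 (UpperHalfPlane.upperHalfPlaneSet \ A)) (𝓝 1) ∧
      Tendsto (fun ξ : ℂ => deriv (fun x => Φ x) ξ)
        (cocompact ℂ ⊓ 𝓟 (UpperHalfPlane.upperHalfPlaneSet \ A)) (𝓝 1) := by
  intro H0 A Φ hA hΦ
  obtain ⟨d, hd0, -, hd⟩ := IsStarHull.exists_hasRestrictionDeriv_holds hA hΦ
  set Ψ := invertedMap Φ d hd0 0 with hΨdef
  obtain ⟨hΨr, hΨd⟩ := isRestrictionMap_invertedMap hΦ hd hd0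
  obtain ⟨hIm, hDer⟩ := H0 (invHull A) Ψ d (isStarHull_invHull hA) hΨr hΨd
  have hdC : (d : ℂ) ≠ 0 := ofReal_ne_zero.2 hd0.ne'
  have hopen : IsOpen (upperHalfPlaneSet \ A) := hA.1.isOpen_diff
  have hopen' : IsOpen (upperHalfPlaneSet \ invHull A) := (isBoundedHull_invHull hA).isOpen_diff
  have hF3 : Tendsto (fun ξ : ℂ ↦ -ξ⁻¹) (cocompact ℂ ⊓ 𝓟 (upperHalfPlaneSet \ A))
      (𝓝[upperHalfPlaneSet \ invHull A] 0) := by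
    have h := tendsto_neg_inv_cocompact_inf (invHull A)
    rwa [invHull_invHull] at h
  have hmem : ∀ᶠ ξ in cocompact ℂ ⊓ 𝓟 (upperHalfPlaneSet \ A), ξ ∈ upperHalfPlaneSet \ A :=
    mem_inf_of_right (mem_principal_self _)
  have hw : ∀ ξ ∈ upperHalfPlaneSet \ A, -ξ⁻¹ ∈ upperHalfPlaneSet \ invHull A := fun ξ hξ ↦ by
    apply neg_inv_mem_diff
    rwa [invHull_invHull]
  have hΨ0 : ∀ ξ ∈ upperHalfPlaneSet \ A, Ψ (-ξ⁻¹) ≠ 0 := fun ξ hξ ↦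
    upperHalfPlaneSet_subset_ne_zero (Ψ.mapsTo (hw ξ hξ))
  have hΦΨ : ∀ ξ ∈ upperHalfPlaneSet \ A, Φ ξ = (d : ℂ) * (-(Ψ (-ξ⁻¹))⁻¹) := fun ξ hξ ↦ by
    rw [hΨdef, invertedMap_zero_apply Φ hd0 (hw ξ hξ), neg_inv_neg_inv,
      negInvConj_negInvConj hd0.ne']
  constructor
  · -- `Im Φ(ξ)/Im ξ → 1`
    have hnorm : Tendsto (fun w ↦ ‖Ψ w / w‖ ^ 2) (𝓝[upperHalfPlaneSet \ invHull A] 0)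
        (𝓝 (d ^ 2)) := by
      have h := hΨd.norm.pow 2
      rwa [Complex.norm_real, Real.norm_of_nonneg hd0.le] at h
    have hG : Tendsto (fun w ↦ d * ((Ψ w).im / w.im) / ‖Ψ w / w‖ ^ 2)
        (𝓝[upperHalfPlaneSet \ invHull A] 0) (𝓝 (d * d / d ^ 2)) :=
      (hIm.const_mul d).div hnorm (pow_ne_zero 2 hd0.ne')
    rw [show d * d / d ^ 2 = 1 by rw [sq, div_self (mul_ne_zero hd0.ne' hd0.ne')]] at hG
    refine (hG.comp hF3).congr' ?_
    filter_upwards [hmem] with ξ hξ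
    have hξ0 : ξ ≠ 0 := diff_subset_ne_zero _ hξ
    have hξi : ξ.im ≠ 0 := (show 0 < ξ.im from hξ.1).ne'
    rw [Function.comp_apply, hΦΨ ξ hξ]
    exact (im_div_im_negInvConj d (hΨ0 ξ hξ) hξ0 hξi).symm
  · -- `Φ'(ξ) → 1`
    have hG : Tendsto (fun w ↦ (d : ℂ) * deriv (fun x ↦ Ψ x) w / (Ψ w / w) ^ 2)
        (𝓝[upperHalfPlaneSet \ invHull A] 0) (𝓝 ((d : ℂ) * d / (d : ℂ) ^ 2)) :=
      (hDer.const_mul (d : ℂ)).div (hΨd.pow 2) (pow_ne_zero 2 hdC)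
    rw [show (d : ℂ) * d / (d : ℂ) ^ 2 = 1 by rw [sq, div_self (mul_ne_zero hdC hdC)]] at hG
    refine (hG.comp hF3).congr' ?_
    filter_upwards [hmem] with ξ hξ
    have hξ0 : ξ ≠ 0 := diff_subset_ne_zero _ hξ
    have hΨ' : HasDerivAt (fun x ↦ Ψ x) (deriv (fun x ↦ Ψ x) (-ξ⁻¹)) (-ξ⁻¹) :=
      ((Ψ.differentiableOn_coe _ (hw ξ hξ)).differentiableAt (hopen'.mem_nhds (hw ξ hξ))).hasDerivAt
    have hc1 : HasDerivAt (fun x : ℂ ↦ Ψ (-x⁻¹)) (deriv (fun x ↦ Ψ x) (-ξ⁻¹) * (ξ ^ 2)⁻¹) ξ :=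
      hΨ'.comp ξ (hasDerivAt_neg_inv hξ0)
    have hc2 := (hasDerivAt_neg_inv (hΨ0 ξ hξ)).comp ξ hc1
    have hH : HasDerivAt (fun x : ℂ ↦ (d : ℂ) * (-(Ψ (-x⁻¹))⁻¹))
        ((d : ℂ) * (((Ψ (-ξ⁻¹)) ^ 2)⁻¹ * (deriv (fun x ↦ Ψ x) (-ξ⁻¹) * (ξ ^ 2)⁻¹))) ξ :=
      hc2.const_mul (d : ℂ)
    have heq : (fun x ↦ Φ x) =ᶠ[𝓝 ξ] fun x : ℂ ↦ (d : ℂ) * (-(Ψ (-x⁻¹))⁻¹) := by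
      filter_upwards [hopen.mem_nhds hξ] with x hx using hΦΨ x hx
    rw [Function.comp_apply, heq.deriv_eq, hH.deriv]
    exact (deriv_negInvConj_eq _ _ (hΨ0 ξ hξ) hξ0).symm

/-- **Registered stub `stub_restrictionMapAtInfty`** of the line `fk-anchor-transfer` (crux
`IsingBoundaryRatio`), verbatim: the statement at `0` for all `*`-hulls implies the statement at
`∞` for all `*`-hulls (`restrictionMapAtInfty_of_atZero`). -/
theorem stub_restrictionMapAtInfty :
    (∀ (A : Set ℂ) (Φ : ConformalEquiv (UpperHalfPlane.upperHalfPlaneSet \ A) UpperHalfPlane.upperHalfPlaneSet)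
      (d : ℝ), IsStarHull A → IsRestrictionMap A Φ → HasRestrictionDeriv A Φ d →
      Tendsto (fun ζ : ℂ => (Φ ζ).im / ζ.im) (𝓝[UpperHalfPlane.upperHalfPlaneSet \ A] 0) (𝓝 d) ∧
      Tendsto (fun ζ : ℂ => deriv (fun x => Φ x) ζ) (𝓝[UpperHalfPlane.upperHalfPlaneSet \ A] 0)
        (𝓝 (d : ℂ))) →
    ∀ (A : Set ℂ) (Φ : ConformalEquiv (UpperHalfPlane.upperHalfPlaneSet \ A) UpperHalfPlane.upperHalfPlaneSet),
      IsStarHull A → IsRestrictionMap A Φ →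
      Tendsto (fun ξ : ℂ => (Φ ξ).im / ξ.im)
        (cocompact ℂ ⊓ 𝓟 (UpperHalfPlane.upperHalfPlaneSet \ A)) (𝓝 1) ∧
      Tendsto (fun ξ : ℂ => deriv (fun x => Φ x) ξ)
        (cocompact ℂ ⊓ 𝓟 (UpperHalfPlane.upperHalfPlaneSet \ A)) (𝓝 1) :=
  restrictionMapAtInfty_of_atZero

end Summit.CriticalPhenomena.SAWScalingLimit.Theorems.IsingBoundaryRatio
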